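import Summits.RiemannHypothesis.RiemannHypothesis.Theorems.SignConeGradedFamilyShadows
import Summits.RiemannHypothesis.RiemannHypothesis.Theorems.SignConeGapRungOne
import Summits.RiemannHypothesis.RiemannHypothesis.Theorems.SignConeSignConeOscillatoryIffInequality

/-!
# Line `near-clean-three` — G4 ladder-down rung below `SignConeOscillatory` (stmt-RiemannHypothesis-16302)

Top of the ladder: the banked crux `SignConeOscillatory` (≡ `SignConeInequality` ≡ RH in-tree:
`signConeOscillatory_iff_signConeInequality`, `signConeInequality_iff_riemannHypothesis`).

Parameter family (NEAR-CLEAN ladder, `Theorems.SignConeGradedFamilyDefs.NearCleanRung`):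
`NearCleanRung t₀` := the unit-slack sign-cone inequality, at EVERY cutoff, for node-nonnegative autocorrelation
tests whose real part is `≥ 0` for `|t| ≥ t₀` (far-field negativity, if any, only below height `t₀`).
Antitone in `t₀`; `t₀ = log 2` is the closed item `SignConeFarField`; `X ↔ ∀ t₀, NearCleanRung t₀`
(`signConeInequality_iff_forall_nearCleanRung`), so the ladder's limit is the top.

* FLOOR (landed): `nearCleanRung_thirteen_fifths : NearCleanRung (13/5)` — erasure with the PLAIN pointwise
  certificate `pwCert13s` (no Dirichlet-SOS tail), `Theorems/SignConeGapRungOneErasure.lean`.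
* RUNG of this line: `NearCleanThree := NearCleanRung 3` — negativity anywhere below height `3`
  (node gaps `2 … 20`, since `log 20 < 3 < log 21`), every cutoff.
* The ONE new input: a PLAIN (SOS-free, hence support-free) pointwise certificate with plateau `L = 3` and knot
  values `≤ 1` whose density is certified `≥ 0` on a y-grid out to the plain tail threshold
  `Y₁ ≈ 2·exp(Σₙ aₙ + 0.14)` (`≈ 1.1·10⁴` for the weights of the SOS certificate `pwCert32`; smaller after a
  re-design penalising `Σₙ aₙ`).  The landed cutoff certificates `pwCert75` / `pwCert32` / `pwCert85` carry
  Dirichlet-SOS tails with frequencies beyond `2b` and do NOT transfer to arbitrary cutoffs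
  (docstring of `SignConeGapRungOneErasure`).

Stubs: `stub_nearCleanRung_of_plainChecks` (class soundness of plain erasure certificates for the near-clean
ladder, generic in the data; pattern `unitSlack_of_clean_beyond_thirteen_fifths`) and
`stub_plainCert_plateau_three` (existence of the certificate: LP design + kernel-checked grid, the compute-bound
step).  `NearCleanThree_of : NearCleanThree` composes them by name WITHOUT mentioning the top (`NearCleanThree_of_stubs` is the arrow form); `top_implies_NearCleanThree` is the on-path
certificate (the top implies the rung by landed theorems).
-/

noncomputable section

set_option linter.dupNamespace false

open scoped BigOperators

namespace Summit.RiemannHypothesis.RiemannHypothesis.Cruxes.SignConeOscillatory.NearCleanThree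

open Summit.RiemannHypothesis.RiemannHypothesis.Theorems.SignCone
open Summit.RiemannHypothesis.RiemannHypothesis.Theses.SignCone (SignConeOscillatory SignConeInequality)

/-- **The rung**: the near-clean rung at height `3` — the unit-slack sign-cone inequality at every cutoff for
node-nonnegative autocorrelation tests whose far-field negativity lies entirely below height `3`. [folklore] -/
def NearCleanThree : Prop := NearCleanRung 3

/-- Stub 1 (class soundness, S–M): a PLAIN pointwise certificate — slack `1`, knot spacing `h > 0`, knot values
`≤ 1` (so `E_χ ≤ e^{x/2}+e^{-x/2}` everywhere and `= ` it on the plateau `[0, L]`), fake weights `≥ 0` on nodes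
`≥ 2`, density `F_D ≥ 0` on the whole real line — proves the near-clean rung at its plateau height `L`, at EVERY
cutoff (erasure is legal exactly where `Re F ≥ 0`, i.e. beyond `L`). Generic form of
`unitSlack_of_clean_beyond_thirteen_fifths`. [folklore] -/
theorem stub_nearCleanRung_of_plainChecks :
    ∀ D : PWData, D.s = 1 → 0 < D.d.h → (∀ q ∈ D.d.chi, q ≤ 1) → (∀ n ∈ D.nodeList, 2 ≤ n) →
      (∀ n ∈ D.nodeList, 0 ≤ D.a n) → (∀ y : ℝ, 0 ≤ D.F y) → NearCleanRung ((D.d.L : ℚ) : ℝ) := by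
  sorry

/-- Stub 2 (the compute-bound step, L): a plain pointwise certificate with plateau `L = 3` EXISTS — an LP design
(kernel taper with knots `≤ 1`, fake weights on nodes `3 … ~20`) whose density is certified non-negative for all
real `y` (kernel-checked grid on `[0, Y₁]`, trivial tail beyond `Y₁ ≈ 2e^{Σ aₙ + 0.14}`; NO Dirichlet-SOS tail). [folklore] -/
theorem stub_plainCert_plateau_three :
    ∃ D : PWData, D.s = 1 ∧ D.d.L = 3 ∧ 0 < D.d.h ∧ (∀ q ∈ D.d.chi, q ≤ 1) ∧ (∀ n ∈ D.nodeList, 2 ≤ n) ∧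
      (∀ n ∈ D.nodeList, 0 ≤ D.a n) ∧ ∀ y : ℝ, 0 ≤ D.F y := by
  sorry

/-- **Composition** (kernel-checked, top not mentioned): the rung from the two registered stubs, used BY NAME and
discharged inside the proof (skeleton form). [folklore] -/
theorem NearCleanThree_of : NearCleanThree := by
  obtain ⟨D, hs, hL, hh, hchi, hnodes, ha, hF⟩ := stub_plainCert_plateau_three
  have h := stub_nearCleanRung_of_plainChecks D hs hh hchi hnodes ha hF
  rw [hL] at h
  have h3 : ((3 : ℚ) : ℝ) = 3 := by norm_num
  rw [h3] at h
  exact h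

/-- The same composition in arrow form (soundness → certificate → rung), for readers and probes. [folklore] -/
theorem NearCleanThree_of_stubs :
    (∀ D : PWData, D.s = 1 → 0 < D.d.h → (∀ q ∈ D.d.chi, q ≤ 1) → (∀ n ∈ D.nodeList, 2 ≤ n) →
      (∀ n ∈ D.nodeList, 0 ≤ D.a n) → (∀ y : ℝ, 0 ≤ D.F y) → NearCleanRung ((D.d.L : ℚ) : ℝ)) →
    (∃ D : PWData, D.s = 1 ∧ D.d.L = 3 ∧ 0 < D.d.h ∧ (∀ q ∈ D.d.chi, q ≤ 1) ∧ (∀ n ∈ D.nodeList, 2 ≤ n) ∧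
      (∀ n ∈ D.nodeList, 0 ≤ D.a n) ∧ ∀ y : ℝ, 0 ≤ D.F y) →
    NearCleanThree := by
  intro hsound hcert
  obtain ⟨D, hs, hL, hh, hchi, hnodes, ha, hF⟩ := hcert
  have h := hsound D hs hh hchi hnodes ha hF
  rw [hL] at h
  have h3 : ((3 : ℚ) : ℝ) = 3 := by norm_num
  rw [h3] at h
  exact h

/-- On-path certificate: the TOP implies the rung (landed: the oscillatory crux is `X`, and `X` gives every
near-clean rung). [folklore] -/
theorem top_implies_NearCleanThree (h : SignConeOscillatory) : NearCleanThree :=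
  nearCleanRung_of_signConeInequality (signConeOscillatory_iff_signConeInequality.1 h) 3

/-- The floor sits below the rung (antitone ladder): the rung implies the landed floor. [folklore] -/
theorem floor_of_NearCleanThree (h : NearCleanThree) : NearCleanRung (13 / 5) :=
  nearCleanRung_anti (by norm_num) h

end Summit.RiemannHypothesis.RiemannHypothesis.Cruxes.SignConeOscillatory.NearCleanThree

end
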